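import Summits.Schanuel.Schanuel.Theses.RoyCriterion

/-!
# Sketch (crux-ideate round 2, ideator 4) — `same-level-dirichlet-probe` and `total-closeness-ledger`

First-lemma signatures for the idea card `Ideas/same-level-dirichlet-probe.md` on the crux
`Summit.Schanuel.Schanuel.Theses.RoyCriterion.RoySmallValueDirichletGap` (item stmt-Schanuel-1050).
Nothing here is proved; the point is that the statements ELABORATE over existing declarations
(`Literature.NumberTheory.Transcendental.royD`, `…mvPolyHeight`, Mathlib).

* `SubDirichletBody`     — the probe family: integer polynomials of degree ≤ D, height ≤ e^Y with
                           T small `𝒟₁`-jets at `(ξ, η)`; inhabited at EVERY point when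
                           `T·U < (D²/2)·Y` asymptotically (Dirichlet; in tree:
                           `RoySmallValueDirichletGapDirichlet.hyp_below_edge`).
* `SmallValueSeq`        — the crux hypothesis in sequence form.
* `DirichletRigidEnemy`  — FIRST LEMMA (A2 of the card): under the hypothesis at
                           `ν = 2 + β − τ + δ` and `¬(ξ, η ∈ ℚ̄)`, for all large `D` there is a finite
                           non-empty set of algebraic points of `ℂ × ℂˣ` (Roy's 0-cycle `Z_D`), one of
                           them within `exp(−c₀ D^{δ+β−τ})` of `(ξ, η)`, on which EVERY member of the
                           sub-Dirichlet body at EVERY level `D'' ∈ [D^{1−κ}, D]` vanishes to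
                           `𝒟₁`-order `(1 − c)·T''` — for every `δ > 0` (no `T/T*` loss).
* `Absorption`           — (A1 of the card): the hypothesis polynomial's own derivatives
                           `𝒟₁ʲ P_D`, `j < 3⌊D^τ⌋ − ⌈C·D^{τ−δ}⌉ − D`, vanish on the same set
                           (paper constants give `C = 400`, `c₀ = 1/25`).
* `TotalClosenessLedger` — FIRST LEMMA of the second card `Ideas/total-closeness-ledger.md`:
                           the near common zeros of `P̃_D, Q_D` carry total weighted closeness
                           `≥ (1−o(1))·T·U` (conservation; no orbit selection), plus the exponent
                           margins `swarm_budget_exponent`, `concentrated_transition_exponent`,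
                           `round1_transition_exponent_fails`.
* `crux_iff'`            — read-back of the crux (sanity).
-/

noncomputable section

namespace Summit.Schanuel.Schanuel.Cruxes.RoySmallValueDirichletGap.SketchIdeator4

open MvPolynomial Filter Complex
open Literature.NumberTheory.Transcendental (royD mvPolyHeight)
open Summit.Schanuel.Schanuel.Theses.RoyCriterion (RoySmallValueDirichletGap)

/-- The sub-Dirichlet probe family at level `D`: nonzero `Q ∈ ℤ[X₁,X₂]`, `deg Q ≤ D`,
`‖Q‖ ≤ e^Y`, `|𝒟₁ⁱ Q(ξ,η)| ≤ e^{−U}` for `i < T`. -/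
def SubDirichletBody (D T : ℕ) (ξ η : ℂ) (Y U : ℝ) : Set (MvPolynomial (Fin 2) ℤ) :=
  {Q | Q ≠ 0 ∧ Q.totalDegree ≤ D ∧ (mvPolyHeight Q : ℝ) ≤ Real.exp Y ∧
    ∀ i : ℕ, i < T → ‖aeval ![ξ, η] (royD^[i] Q)‖ ≤ Real.exp (-U)}

/-- The crux hypothesis in sequence form (`P D` is Roy's `P_D`). -/
def SmallValueSeq (P : ℕ → MvPolynomial (Fin 2) ℤ) (ξ η : ℂ) (β τ ν : ℝ) : Prop :=
  ∀ᶠ D : ℕ in atTop, P D ≠ 0 ∧ (P D).totalDegree ≤ D ∧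
    (mvPolyHeight (P D) : ℝ) ≤ Real.exp ((D : ℝ) ^ β) ∧
    ∀ i : ℕ, i < 3 * ⌊(D : ℝ) ^ τ⌋₊ → ‖aeval ![ξ, η] (royD^[i] (P D))‖ ≤ Real.exp (-(D : ℝ) ^ ν)

/-- `Q` vanishes to `𝒟₁`-order `m` at the point `α = (x, y)`. -/
def VanishesToOrder (Q : MvPolynomial (Fin 2) ℤ) (α : ℂ × ℂ) (m : ℕ) : Prop :=
  ∀ i : ℕ, i < m → aeval ![α.1, α.2] (royD^[i] Q) = 0

/-- **FIRST LEMMA (card, A2) — Dirichlet-rigidity of Roy's enemy, for every `δ > 0`.**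
Informal: `¬(ξ,η ∈ ℚ̄)` + hypothesis at `ν = 2+β−τ+δ` ⇒ for all large `D` Roy's 0-cycle `Z_D`
(here: a finite non-empty set `S` of algebraic points of `ℂ × ℂˣ`, one within `e^{−c₀D^{δ+β−τ}}` of
`(ξ,η)`) lies in the base locus — with multiplicity `(1−c)T''` — of the sub-Dirichlet body
`SubDirichletBody D'' T'' ξ η (D''^{β+δ−ε}) (D''^{2+β−τ+ε'})`, `T'' = ⌊c' D^τ⌋`, at EVERY level
`D'' ∈ [D^{1−κ}, D]`. Proof route: tree `LevelPkg.step2_level` (budget `(D^δ/25)(D^β deg Z + D h Z)`)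
+ `ZeroConfigK.step45_combined` instantiated with `Ds = D''`, `Ts = T''` (ratio `T/Ts = O(1)`), the
floor `U'' ≥ 31·D^{2+β−τ}` from `step3_bounds`. -/
def DirichletRigidEnemy : Prop :=
  ∀ (ξ η : ℂ), η ≠ 0 → ¬ (IsAlgebraic ℚ ξ ∧ IsAlgebraic ℚ η) →
  ∀ (β τ δ ε ε' : ℝ), 1 < τ → τ < 2 → τ < β → 0 < δ → 0 < ε → 0 < ε' → ε + ε' < δ →
    max 0 ((2 * τ - 3) / (τ - 1)) * δ < ε + ε' →
  ∀ (P : ℕ → MvPolynomial (Fin 2) ℤ), SmallValueSeq P ξ η β τ (2 + β - τ + δ) →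
    ∃ κ : ℝ, 0 < κ ∧ ∃ c : ℝ, 0 < c ∧ c < 1 ∧ ∃ c' : ℝ, 0 < c' ∧ ∃ c₀ : ℝ, 0 < c₀ ∧
    ∀ᶠ D : ℕ in atTop, ∃ S : Finset (ℂ × ℂ), S.Nonempty ∧
      (∀ α ∈ S, α.2 ≠ 0 ∧ IsAlgebraic ℚ α.1 ∧ IsAlgebraic ℚ α.2) ∧
      (∃ α ∈ S, dist α (ξ, η) ≤ Real.exp (-(c₀ * (D : ℝ) ^ (δ + β - τ)))) ∧
      ∀ D'' : ℕ, (D : ℝ) ^ (1 - κ) ≤ D'' → D'' ≤ D →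
        ∀ Q ∈ SubDirichletBody D'' ⌊c' * (D : ℝ) ^ τ⌋₊ ξ η ((D'' : ℝ) ^ (β + δ - ε))
            ((D'' : ℝ) ^ (2 + β - τ + ε')),
          ∀ α ∈ S, VanishesToOrder Q α ⌊(1 - c) * (c' * (D : ℝ) ^ τ)⌋₊

/-- **(card, A1) — Absorption.** Same setting; the hypothesis polynomial itself vanishes on `S` to
`𝒟₁`-order `3⌊D^τ⌋ − ⌈C·D^{τ−δ}⌉ − D` (paper constants: `C = 400`; the `−D` absorbs Roy's monomial shift `X₁^a X₂^{−b}`;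
Roy's construction only gives order `2⌊D^τ⌋`). Probe: `Q := 𝒟₁ʲ P̃_D`, `j ∈ [2T, 3T − T♭)`. -/
def Absorption : Prop :=
  ∀ (ξ η : ℂ), η ≠ 0 → ¬ (IsAlgebraic ℚ ξ ∧ IsAlgebraic ℚ η) →
  ∀ (β τ δ : ℝ), 1 < τ → τ < 2 → τ < β → 0 < δ →
  ∀ (P : ℕ → MvPolynomial (Fin 2) ℤ), SmallValueSeq P ξ η β τ (2 + β - τ + δ) →
    ∃ C : ℝ, 0 < C ∧ ∃ c₀ : ℝ, 0 < c₀ ∧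
    ∀ᶠ D : ℕ in atTop, ∃ S : Finset (ℂ × ℂ), S.Nonempty ∧
      (∀ α ∈ S, α.2 ≠ 0 ∧ IsAlgebraic ℚ α.1 ∧ IsAlgebraic ℚ α.2) ∧
      (∃ α ∈ S, dist α (ξ, η) ≤ Real.exp (-(c₀ * (D : ℝ) ^ (δ + β - τ)))) ∧
      ∀ α ∈ S, VanishesToOrder (P D) α
        (3 * ⌊(D : ℝ) ^ τ⌋₊ - ⌈C * (D : ℝ) ^ (τ - δ)⌉₊ - D)

/-- The probe inequality behind both statements, as pure bookkeeping (Roy §7 Step 5 with `T* := T''`,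
`D* := D''`): if `κ D^δ (D^β d + D h) ≤ (T/T'' + 1)(A·Y'' d + D'' h)` with `T ≤ T''/c₀`, `D'' ≤ D`,
`Y'' ≤ D^{β+δ−ε}`, `d ≥ 1`, `h ≥ 0`, then `D` is bounded. (Real analysis only; the analogue of the
tree's `Roy2013.endgame_step` with ratio `O(1)` — no `δ_R` appears.) -/
def ProbeBookkeeping : Prop :=
  ∀ (β δ ε κ A c₀ : ℝ), 0 < δ → 0 < ε → ε < δ → 0 < κ → 0 < A → 0 < c₀ →
    ∃ D₀ : ℝ, ∀ (D D'' T T'' d h : ℝ), D₀ ≤ D → 1 ≤ D'' → D'' ≤ D → 0 < T'' → T ≤ T'' / c₀ →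
      1 ≤ d → 0 ≤ h →
      ¬ (κ * D ^ δ * (D ^ β * d + D * h) ≤ (T / T'' + 1) * (A * D ^ (β + δ - ε) * d + D'' * h))

/-- `y ≤ D^e` once `D ≥ y^{1/e}` (`y ≥ 0`, `e > 0`). -/
theorem le_rpow_of_rpow_inv_le {y e D : ℝ} (hy : 0 ≤ y) (he : 0 < e)
    (hD : y ^ (1 / e) ≤ D) : y ≤ D ^ e := by
  have h1 : (y ^ (1 / e)) ^ e ≤ D ^ e := Real.rpow_le_rpow (Real.rpow_nonneg hy _) hD he.le
  have h2 : (y ^ (1 / e)) ^ e = y := by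
    rw [← Real.rpow_mul hy, one_div, inv_mul_cancel₀ he.ne', Real.rpow_one]
  rwa [h2] at h1

/-- **`ProbeBookkeeping` holds** (the `δ_R`-free endgame: pure real analysis). -/
theorem probeBookkeeping_holds : ProbeBookkeeping := by
  intro β δ ε κ A c₀ hδ hε hεδ hκ hA hc₀
  set M : ℝ := 1 / c₀ + 1 with hM
  have hM0 : 0 < M := by rw [hM]; positivity
  -- thresholds: `κ D^ε > M A` and `κ D^δ ≥ M`
  set y₁ : ℝ := M * A / κ + 1 with hy₁
  set y₂ : ℝ := M / κ + 1 with hy₂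
  have hy₁0 : 0 ≤ y₁ := by rw [hy₁]; positivity
  have hy₂0 : 0 ≤ y₂ := by rw [hy₂]; positivity
  refine ⟨max 1 (max (y₁ ^ (1 / ε)) (y₂ ^ (1 / δ))), ?_⟩
  intro D D'' T T'' d h hD hD''1 hD''D hT'' hTT'' hd hh hle
  have hD1 : 1 ≤ D := le_trans (le_max_left _ _) hD
  have hD0 : 0 < D := by linarith
  have hDε : y₁ ≤ D ^ ε :=
    le_rpow_of_rpow_inv_le hy₁0 hε (le_trans ((le_max_left _ _).trans (le_max_right _ _)) hD)
  have hDδ : y₂ ≤ D ^ δ :=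
    le_rpow_of_rpow_inv_le hy₂0 hδ (le_trans ((le_max_right _ _).trans (le_max_right _ _)) hD)
  -- the ratio `T/T'' + 1 ≤ M`
  have hratio : T / T'' + 1 ≤ M := by
    rw [hM]
    have : T / T'' ≤ 1 / c₀ := by
      rw [div_le_iff₀ hT'', one_div, ← div_eq_inv_mul]
      exact hTT''
    linarith
  -- bound the right-hand side by `M (A D^{β+δ−ε} d + D h)`
  have hpow0 : 0 < D ^ (β + δ - ε) := Real.rpow_pos_of_pos hD0 _
  have hd0 : 0 < d := by linarith
  have hinner : A * D ^ (β + δ - ε) * d + D'' * h ≤ A * D ^ (β + δ - ε) * d + D * h := by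
    have := mul_le_mul_of_nonneg_right hD''D hh
    linarith
  have hinner0 : 0 ≤ A * D ^ (β + δ - ε) * d + D'' * h := by
    have : 0 ≤ D'' * h := mul_nonneg (by linarith) hh
    positivity
  have hRHS : (T / T'' + 1) * (A * D ^ (β + δ - ε) * d + D'' * h) ≤
      M * (A * D ^ (β + δ - ε) * d + D * h) := by
    calc (T / T'' + 1) * (A * D ^ (β + δ - ε) * d + D'' * h)
        ≤ M * (A * D ^ (β + δ - ε) * d + D'' * h) := mul_le_mul_of_nonneg_right hratio hinner0
      _ ≤ M * (A * D ^ (β + δ - ε) * d + D * h) := mul_le_mul_of_nonneg_left hinner hM0.le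
  -- lower-bound the left-hand side
  have hsplit : D ^ δ * D ^ β = D ^ ε * D ^ (β + δ - ε) := by
    rw [← Real.rpow_add hD0, ← Real.rpow_add hD0]; ring_nf
  have hκε : M * A < κ * D ^ ε := by
    have h1 : M * A / κ < y₁ := by rw [hy₁]; linarith
    have h2 : M * A / κ < D ^ ε := lt_of_lt_of_le h1 hDε
    rw [div_lt_iff₀ hκ] at h2
    linarith [mul_comm (D ^ ε) κ]
  have hκδ : M ≤ κ * D ^ δ := by
    have h1 : M / κ < y₂ := by rw [hy₂]; linarith
    have h2 : M / κ < D ^ δ := lt_of_lt_of_le h1 hDδ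
    rw [div_lt_iff₀ hκ] at h2
    linarith [mul_comm (D ^ δ) κ]
  have hterm1 : M * (A * D ^ (β + δ - ε) * d) < κ * D ^ δ * (D ^ β * d) := by
    have e1 : κ * D ^ δ * (D ^ β * d) = (κ * D ^ ε) * (D ^ (β + δ - ε) * d) := by
      calc κ * D ^ δ * (D ^ β * d) = κ * (D ^ δ * D ^ β) * d := by ring
        _ = κ * (D ^ ε * D ^ (β + δ - ε)) * d := by rw [hsplit]
        _ = (κ * D ^ ε) * (D ^ (β + δ - ε) * d) := by ring
    rw [e1, show M * (A * D ^ (β + δ - ε) * d) = (M * A) * (D ^ (β + δ - ε) * d) by ring]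
    exact mul_lt_mul_of_pos_right hκε (mul_pos hpow0 hd0)
  have hterm2 : M * (D * h) ≤ κ * D ^ δ * (D * h) :=
    mul_le_mul_of_nonneg_right hκδ (mul_nonneg hD0.le hh)
  have hLHS : M * (A * D ^ (β + δ - ε) * d + D * h) < κ * D ^ δ * (D ^ β * d + D * h) := by
    have : κ * D ^ δ * (D ^ β * d + D * h) = κ * D ^ δ * (D ^ β * d) + κ * D ^ δ * (D * h) := by ring
    rw [this, mul_add]
    linarith
  linarith

/-! ## Card B — `total-closeness-ledger` (no orbit selection) -/

/-- **FIRST LEMMA (card B) — the total-closeness ledger / conservation law at ONE level.**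
Informal: under the hypothesis at level `D` alone (Roy Steps 1–2: Prop 6.1 Schwarz bound
`h_𝒞(div P̃_D · div Q_D) ≤ −TU + 3D²Y`, Prop 2.3 TWO-SIDED, and the Prop 4.5 LOWER bound
`|I_D^{(γ,T)}|_α ≥ T^{−7T log T}·max(dist(α,γ)^T, dist(α,A_γ))`, which makes every zero far from
`γ` contribute `≥ 0`), the common zeros `α_j` (multiplicities `e_j`, `∑ e_j ≤ D²`) of `P̃_D` and
`Q_D = ∑_{i≤D} a_i 𝒟ⁱP̃_D` that lie near `γ` carry ALL the smallness:
`∑_{near j} e_j · max{T log dist(α_j,γ), log dist(α_j, A_γ)} ≤ −(1−o(1))·T·U`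
(`T = ⌊D^τ⌋`, `U = D^ν/4` in the tree's normalisation) — versus Roy's selected component, which is
certified to carry only `(D^δ/25)(D^β deg Z + D h Z) ≪ TU`. Tree: `Roy2013.step2_core` is exactly the
test-family product inequality over ALL zeros before `step2_select`. -/
def TotalClosenessLedger : Prop :=
  ∀ (ξ η : ℂ), η ≠ 0 → ¬ (IsAlgebraic ℚ ξ ∧ IsAlgebraic ℚ η) → ∃ r₀ : ℝ, 0 < r₀ ∧
  ∀ (β τ ν : ℝ), 1 ≤ τ → τ < 2 → τ < β → 2 + β - τ < ν →
  ∀ (P : ℕ → MvPolynomial (Fin 2) ℤ), SmallValueSeq P ξ η β τ ν →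
  ∀ θ : ℝ, θ < 1 →
    ∀ᶠ D : ℕ in atTop, ∃ (n : ℕ) (α : Fin n → ℂ × ℂ) (e : Fin n → ℕ),
      (∀ j, IsAlgebraic ℚ (α j).1 ∧ IsAlgebraic ℚ (α j).2 ∧ (α j).2 ≠ 0 ∧
        aeval ![(α j).1, (α j).2] (P D) = 0) ∧
      (∑ j, e j ≤ D ^ 2) ∧
      (∑ j ∈ Finset.univ.filter (fun j => dist (α j) (ξ, η) ≤ r₀),
          (e j : ℝ) * max (⌊(D : ℝ) ^ τ⌋₊ * Real.log (dist (α j) (ξ, η)))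
            (if 0 < ‖(α j).2 - η * cexp ((α j).1 - ξ)‖
              then Real.log ‖(α j).2 - η * cexp ((α j).1 - ξ)‖
              else ⌊(D : ℝ) ^ τ⌋₊ * Real.log (dist (α j) (ξ, η)))
        ≤ -(θ * ⌊(D : ℝ) ^ τ⌋₊ * (D : ℝ) ^ ν / 4))

/-- Exponent margin of the THIN-SWARM kill (card B, consequence (S)): same-level thin pairs survive
Nesterenko–Waldschmidt only if `∑ m_i h_i ≳ T^{1/2}·U`, i.e. exponent `τ/2 + ν`, while the ledger's
cycle has total height exponent `1 + β`; the gap is `1 − τ/2 + δ > 0` on the whole range. -/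
theorem swarm_budget_exponent {τ β δ : ℝ} (hτ : τ < 2) (hδ : 0 < δ) :
    1 + β < τ / 2 + (2 + β - τ + δ) := by linarith

/-- Exponent margin of the CONCENTRATED-TRANSITION kill (card B, consequence (C)): with per-point
closeness upgraded from `D^{β+δ}` to `D^ν`, the NW cost `H²/L` (`H = 1+β−τ`, `L = ν − τ`) is beaten
by `ν` iff `τ < 2 + 2δ` — always; the round-1 count at Roy's closeness failed iff `2 − τ > 2δ`. -/
theorem concentrated_transition_exponent {τ β δ : ℝ} (hτ : τ < 2) (hδ : 0 < δ) :
    2 * (1 + β - τ) - ((2 + β - τ + δ) - τ) < 2 + β - τ + δ := by linarith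

/-- The round-1 failure at Roy's closeness, for contrast: `H²/L < S` with `S = β + δ`,
`L = β + δ − τ` needs `2 − τ < 2δ`, false near the edge. -/
theorem round1_transition_exponent_fails {τ β δ : ℝ} (h : 2 * δ ≤ 2 - τ) :
    ¬ (2 * (1 + β - τ) - ((β + δ) - τ) < β + δ) := by intro h'; linarith

/-- Read-back of the crux (sanity: the route decl is in scope and has the expected shape). -/
theorem crux_iff' : RoySmallValueDirichletGap ↔
    ∀ (ξ η : ℂ), η ≠ 0 → ∀ (β τ ν : ℝ), 1 ≤ τ → τ < 2 → τ < β → 2 + β - τ < ν →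
      (∀ᶠ D : ℕ in Filter.atTop, ∃ P : MvPolynomial (Fin 2) ℤ, P ≠ 0 ∧ P.totalDegree ≤ D ∧
        (mvPolyHeight P : ℝ) ≤ Real.exp ((D : ℝ) ^ β) ∧
        ∀ i : ℕ, i < 3 * ⌊(D : ℝ) ^ τ⌋₊ →
          ‖MvPolynomial.aeval ![ξ, η] (royD^[i] P)‖ ≤ Real.exp (-(D : ℝ) ^ ν)) →
      IsAlgebraic ℚ ξ ∧ IsAlgebraic ℚ η := Iff.rfl

/-- The hypothesis of the crux at `(ξ,η,β,τ,ν)` yields a `SmallValueSeq` (choice of `P_D`). -/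
theorem smallValueSeq_of_hyp {ξ η : ℂ} {β τ ν : ℝ}
    (h : ∀ᶠ D : ℕ in Filter.atTop, ∃ P : MvPolynomial (Fin 2) ℤ, P ≠ 0 ∧ P.totalDegree ≤ D ∧
        (mvPolyHeight P : ℝ) ≤ Real.exp ((D : ℝ) ^ β) ∧
        ∀ i : ℕ, i < 3 * ⌊(D : ℝ) ^ τ⌋₊ →
          ‖MvPolynomial.aeval ![ξ, η] (royD^[i] P)‖ ≤ Real.exp (-(D : ℝ) ^ ν)) :
    ∃ P : ℕ → MvPolynomial (Fin 2) ℤ, SmallValueSeq P ξ η β τ ν := by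
  classical
  refine ⟨fun D => if hD : ∃ P : MvPolynomial (Fin 2) ℤ, P ≠ 0 ∧ P.totalDegree ≤ D ∧
        (mvPolyHeight P : ℝ) ≤ Real.exp ((D : ℝ) ^ β) ∧
        ∀ i : ℕ, i < 3 * ⌊(D : ℝ) ^ τ⌋₊ →
          ‖MvPolynomial.aeval ![ξ, η] (royD^[i] P)‖ ≤ Real.exp (-(D : ℝ) ^ ν)
      then hD.choose else 0, ?_⟩
  filter_upwards [h] with D hD
  simp only [dif_pos hD]
  exact hD.choose_spec

end Summit.Schanuel.Schanuel.Cruxes.RoySmallValueDirichletGap.SketchIdeator4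

end
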